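import Literature.Barriers.ValiantsHypothesis.FullRankMultilinearBaurStrassen
import Literature.Barriers.ValiantsHypothesis.FullRankMultilinearRank
import Literature.Barriers.ValiantsHypothesis.FullRankMultilinearUnbalancing
import Mathlib.Analysis.Complex.ExponentialBounds
import HarnessLib

/-!
# Alon–Kumar–Volk 2020, Theorem 20: the proof (`AlonKumarVolk2020_thm20_holds`)

Discharges the named fact `Literature.Barriers.ValiantsHypothesis.AlonKumarVolk2020_thm20` of
`FullRankMultilinear.lean`: a universal `c > 0` such that every fan-in-two syntactically
multilinear circuit computing a full-rank `g ∈ K[x_1, …, x_{2n}]` (`n ≥ 2`, any field `K`)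
has at least `c n² / log² n` gates [AlonKumarVolk2020, Thm. 20].

## The argument ([AlonKumarVolk2020, §4]) as formalised

Let `P` compute `g`; cut it down so that its output is its last gate (`exists_normalized`).
Let `Ψ'` be the Baur–Strassen derivative gate list of `FullRankMultilinearBaurStrassen.lean`
(`derivGates`, size `≤ 5|P|`, syntactically multilinear, output `v_x` computing `∂g/∂x` with
`x ∉ X_{v_x}`), `τ = ⌊log₂ 2n⌋ + 1`, `κ = 352(τ+8)` (`tauN`, `kap`; AKV: `τ = 3 log n`,
`100τ`).

* `MVanish`, `Decomp`, `structure_lemma` — RSY08 Prop. 5.5 / 5.8 as used in the proof of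
  [AlonKumarVolk2020, Lemma 23]: the value of every high gate `v` (`|X_v| ≥ N - κ`) is
  `∑_{u ∈ L} c_u h_u + rem` with `u` lower-leveled (`κ < |X_u| < N - κ`) having a high parent
  below `v`, `c_u ∈ K[(X_u)ᶜ]`, and `rem` free of multilinear monomials of degree
  `> 2κ - (N - |X_v|)` (we track the multilinear degree `MVanish`, which is all the rank bound
  needs, instead of the total degree).
* `lemma23` — for each `x`: `v_x` is a high gate (else `∂g/∂x ∈ K[W]`, `|W| ≤ 2n-2`,
  contradicting `rank M(∂g/∂x) ≥ 2^{n-1}`, `AKV.rank_cm_pderiv_ge_of_isFullRank`), and every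
  decomposition set `L` below it has `16 τ |L| ≥ N`: otherwise `exists_balanced_unbalancing`
  gives a balanced `Y` unbalancing all `X_u`, `u ∈ L`, by `τ`, and
  `rank M_Y(∂g/∂x) ≤ |L| 2^{n-2τ} + (2κ+1) n^{2κ} < 2^{n-1}`.
* `size_bound_core` — the double counting of the proof of Thm. 20: `L_x` lies among the
  children of the high gates `p` with `x ∉ X_p`; summing over `x`,
  `N · N/(16τ) ≤ ∑_x |L_x| ≤ 2 ∑_{p high} (N - |X_p|) ≤ 2κ |Ψ'| ≤ 10 κ |P|`.
* `large_regime`, `exists_large`, `size_real_bound`, `AlonKumarVolk2020_thm20_holds` — the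
  conditions `3κ < N`, `2τ ≤ n`, `(2κ+1) n^{2κ} ≤ 2^{n-2}` hold once `34000 log² n ≤ n`
  (`Real.isLittleO_pow_log_id_atTop`), giving `|P| ≥ n²/(675840 log² n)`; smaller `n` are
  absorbed in the constant since `|P| ≥ 1`.

## References
* [AlonKumarVolk2020] N. Alon, M. Kumar, B. L. Volk, *Unbalancing sets and an almost quadratic
  lower bound for syntactically multilinear arithmetic circuits*, Combinatorica 40 (2020)
  149–178 (arXiv:1708.02037: §4, Thm. 20, Thm. 21, Def. 22, Lemma 23).
* [RazYehudayoff2008] R. Raz, A. Yehudayoff, Comput. Complexity 17 (2008), §2.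
-/

noncomputable section

namespace Literature.Barriers.ValiantsHypothesis.AKV

open MvPolynomial Finset RazYehudayoff

variable {K : Type*} [Field K] {σ : Type*} [DecidableEq σ]

/-! ### Multilinear degree: vanishing of the coefficients of large multilinear monomials -/

/-- `MVanish f d`: every multilinear monomial of `f` has degree `≤ d` (all coefficients
`coeff (∏_{A} x) f` with `|A| > d` vanish; non-multilinear monomials are unconstrained).
[folklore] -/
def MVanish (f : MvPolynomial σ K) (d : ℕ) : Prop :=
  ∀ A : Finset σ, d < A.card → coeff (ind A) f = 0

omit [DecidableEq σ] in
/-- Monotonicity in the degree. [folklore] -/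
theorem MVanish.mono {f : MvPolynomial σ K} {d d' : ℕ} (h : MVanish f d) (hd : d ≤ d') :
    MVanish f d' := fun A hA => h A (lt_of_le_of_lt hd hA)

omit [DecidableEq σ] in
/-- `0` has no monomials. [folklore] -/
theorem MVanish.zero (d : ℕ) : MVanish (0 : MvPolynomial σ K) d := fun _ _ => coeff_zero _

omit [DecidableEq σ] in
/-- Sums. [folklore] -/
theorem MVanish.add {f g : MvPolynomial σ K} {d : ℕ} (hf : MVanish f d) (hg : MVanish g d) :
    MVanish (f + g) d := fun A hA => by rw [coeff_add, hf A hA, hg A hA, add_zero]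

omit [DecidableEq σ] in
/-- Scalar multiples. [folklore] -/
theorem MVanish.smul {f : MvPolynomial σ K} {d : ℕ} (hf : MVanish f d) (a : K) :
    MVanish (a • f) d := fun A hA => by rw [coeff_smul, hf A hA, smul_zero]

omit [DecidableEq σ] in
/-- Finite sums. [folklore] -/
theorem MVanish.sum {ι : Type*} (s : Finset ι) {f : ι → MvPolynomial σ K} {d : ℕ}
    (hf : ∀ i ∈ s, MVanish (f i) d) : MVanish (∑ i ∈ s, f i) d := by
  classical
  induction s using Finset.induction_on with
  | empty => simpa using MVanish.zero d
  | insert a s ha ih =>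
    rw [Finset.sum_insert ha]
    exact (hf a (Finset.mem_insert_self a s)).add (ih fun i hi => hf i (Finset.mem_insert_of_mem hi))

omit [DecidableEq σ] in
/-- A polynomial in the variables `W` has no multilinear monomial of degree `> |W|`. [folklore] -/
theorem MVanish.of_supported {f : MvPolynomial σ K} {W : Finset σ}
    (hf : f ∈ supported K (↑W : Set σ)) {d : ℕ} (hd : W.card ≤ d) : MVanish f d := by
  intro A hA
  refine coeff_ind_eq_zero_of_not_subset hf fun hAW => ?_
  have := Finset.card_le_card hAW
  omega

/-- If `m + m' = ind A` then `m = ind B` and `m' = ind (A ∖ B)` for `B = supp m ⊆ A`. [folklore] -/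
theorem eq_ind_of_add_eq_ind {m m' : σ →₀ ℕ} {A : Finset σ} (h : m + m' = ind A) :
    m = ind m.support ∧ m' = ind m'.support ∧ m.support ∪ m'.support = A ∧
      Disjoint m.support m'.support := by
  classical
  have hpt : ∀ x, m x + m' x = if x ∈ A then 1 else 0 := fun x => by
    have := DFunLike.congr_fun h x
    rw [Finsupp.add_apply, ind_apply] at this
    exact this
  have hm : ∀ x, m x ≤ 1 ∧ m' x ≤ 1 ∧ (m x = 1 → m' x = 0) := fun x => by
    have := hpt x
    split_ifs at this <;> omega
  refine ⟨?_, ?_, ?_, ?_⟩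
  · ext x
    rw [ind_apply]
    by_cases hx : x ∈ m.support
    · rw [if_pos hx]
      have := Finsupp.mem_support_iff.1 hx
      have := (hm x).1
      omega
    · rw [if_neg hx]
      exact Finsupp.notMem_support_iff.1 hx
  · ext x
    rw [ind_apply]
    by_cases hx : x ∈ m'.support
    · rw [if_pos hx]
      have := Finsupp.mem_support_iff.1 hx
      have := (hm x).2.1
      omega
    · rw [if_neg hx]
      exact Finsupp.notMem_support_iff.1 hx
  · ext x
    simp only [Finset.mem_union, Finsupp.mem_support_iff]
    have := hpt x
    split_ifs at this with hx
    · simp only [hx, iff_true]; omega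
    · simp only [hx, iff_false]; omega
  · rw [Finset.disjoint_left]
    intro x hx hx'
    rw [Finsupp.mem_support_iff] at hx hx'
    have := (hm x).2.2
    have := (hm x).1
    omega

/-- **Products**: multilinear degrees add. [folklore] -/
theorem MVanish.mul {f g : MvPolynomial σ K} {d e : ℕ} (hf : MVanish f d) (hg : MVanish g e) :
    MVanish (f * g) (d + e) := by
  classical
  intro A hA
  rw [coeff_mul]
  refine Finset.sum_eq_zero fun x hx => ?_
  rw [Finset.mem_antidiagonal] at hx
  obtain ⟨h1, h2, h3, h4⟩ := eq_ind_of_add_eq_ind hx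
  have hcard : x.1.support.card + x.2.support.card = A.card := by
    rw [← h3, Finset.card_union_of_disjoint h4]
  rcases lt_or_ge d x.1.support.card with hd | hd
  · rw [h1, hf _ hd, zero_mul]
  · have he : e < x.2.support.card := by omega
    rw [h2, hg _ he, mul_zero]

/-! ### Decompositions `f = ∑_{u ∈ L} c_u · h_u + rem` -/

section Decomp

variable [Fintype σ] (val : ℕ → MvPolynomial σ K) (Xs : ℕ → Finset σ)

/-- `Decomp val Xs Good f W d`: `f = ∑_{u ∈ L} c_u · val u + rem` with all `u ∈ L` good,
`Xs u ⊆ W`, `c_u ∈ K[(Xs u)ᶜ]`, and `rem` without multilinear monomials of degree `> d`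
(the shape of [AlonKumarVolk2020, Lemma 23] / RSY08 Prop. 5.5). [cite: AlonKumarVolk2020, §4 (Lemma 23)] -/
def Decomp (Good : ℕ → Prop) (f : MvPolynomial σ K) (W : Finset σ) (d : ℕ) : Prop :=
  ∃ (L : Finset ℕ) (c : ℕ → MvPolynomial σ K) (rem : MvPolynomial σ K),
    f = ∑ u ∈ L, c u * val u + rem ∧
      (∀ u ∈ L, Good u ∧ Xs u ⊆ W ∧ c u ∈ supported K (↑(Xs u)ᶜ : Set σ)) ∧ MVanish rem d

variable {val Xs}

/-- Monotonicity of `Decomp` in the goodness predicate, the variable bound and the degree. [folklore] -/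
theorem Decomp.mono {Good Good' : ℕ → Prop} {f : MvPolynomial σ K} {W W' : Finset σ} {d d' : ℕ}
    (h : Decomp val Xs Good f W d) (hG : ∀ u, Good u → Good' u) (hW : W ⊆ W') (hd : d ≤ d') :
    Decomp val Xs Good' f W' d' := by
  obtain ⟨L, c, rem, hf, hL, hrem⟩ := h
  exact ⟨L, c, rem, hf, fun u hu => ⟨hG u (hL u hu).1, (hL u hu).2.1.trans hW, (hL u hu).2.2⟩,
    hrem.mono hd⟩

/-- The trivial decomposition of a low-degree polynomial (`L = ∅`). [folklore] -/
theorem Decomp.of_mvanish {Good : ℕ → Prop} {f : MvPolynomial σ K} (W : Finset σ) {d : ℕ}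
    (hf : MVanish f d) : Decomp val Xs Good f W d :=
  ⟨∅, fun _ => 0, f, by simp, fun u hu => absurd hu (Finset.notMem_empty u), hf⟩

/-- The one-term decomposition `f = c · val p` (`L = {p}`, `rem = 0`). [folklore] -/
theorem Decomp.single {Good : ℕ → Prop} {p : ℕ} (hp : Good p) {W : Finset σ} (hW : Xs p ⊆ W)
    {c : MvPolynomial σ K} (hc : c ∈ supported K (↑(Xs p)ᶜ : Set σ)) (d : ℕ) :
    Decomp val Xs Good (c * val p) W d :=
  ⟨{p}, fun _ => c, 0, by simp, fun u hu => by
    rw [Finset.mem_singleton] at hu; subst hu; exact ⟨hp, hW, hc⟩, MVanish.zero d⟩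

/-- Sums of decompositions. [folklore] -/
theorem Decomp.add {Good : ℕ → Prop} {f g : MvPolynomial σ K} {W : Finset σ} {d : ℕ}
    (hf : Decomp val Xs Good f W d) (hg : Decomp val Xs Good g W d) :
    Decomp val Xs Good (f + g) W d := by
  classical
  obtain ⟨L₁, c₁, r₁, hf, hL₁, hr₁⟩ := hf
  obtain ⟨L₂, c₂, r₂, hg, hL₂, hr₂⟩ := hg
  refine ⟨L₁ ∪ L₂, fun u => (if u ∈ L₁ then c₁ u else 0) + (if u ∈ L₂ then c₂ u else 0),
    r₁ + r₂, ?_, fun u hu => ?_, hr₁.add hr₂⟩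
  · have e1 : ∑ u ∈ L₁ ∪ L₂, (if u ∈ L₁ then c₁ u else 0) * val u = ∑ u ∈ L₁, c₁ u * val u := by
      simp only [ite_mul, zero_mul]
      rw [Finset.sum_ite_mem, Finset.inter_eq_right.2 Finset.subset_union_left]
    have e2 : ∑ u ∈ L₁ ∪ L₂, (if u ∈ L₂ then c₂ u else 0) * val u = ∑ u ∈ L₂, c₂ u * val u := by
      simp only [ite_mul, zero_mul]
      rw [Finset.sum_ite_mem, Finset.inter_eq_right.2 Finset.subset_union_right]
    simp only [add_mul, Finset.sum_add_distrib]
    rw [e1, e2, hf, hg]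
    ring
  · rw [Finset.mem_union] at hu
    refine ⟨?_, ?_, ?_⟩
    · rcases hu with hu | hu
      · exact (hL₁ u hu).1
      · exact (hL₂ u hu).1
    · rcases hu with hu | hu
      · exact (hL₁ u hu).2.1
      · exact (hL₂ u hu).2.1
    · refine Subalgebra.add_mem _ ?_ ?_
      · split_ifs with h
        · exact (hL₁ u h).2.2
        · exact Subalgebra.zero_mem _
      · split_ifs with h
        · exact (hL₂ u h).2.2
        · exact Subalgebra.zero_mem _

/-- Finite sums of decompositions. [folklore] -/
theorem Decomp.sum {Good : ℕ → Prop} {ι : Type*} (s : Finset ι) {f : ι → MvPolynomial σ K}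
    {W : Finset σ} {d : ℕ} (hf : ∀ i ∈ s, Decomp val Xs Good (f i) W d) :
    Decomp val Xs Good (∑ i ∈ s, f i) W d := by
  classical
  induction s using Finset.induction_on with
  | empty => simpa using Decomp.of_mvanish (val := val) (Xs := Xs) W (MVanish.zero d)
  | insert a s ha ih =>
    rw [Finset.sum_insert ha]
    exact (hf a (Finset.mem_insert_self a s)).add (ih fun i hi => hf i (Finset.mem_insert_of_mem hi))

/-- Scalar multiples of decompositions. [folklore] -/
theorem Decomp.smul {Good : ℕ → Prop} {f : MvPolynomial σ K} {W : Finset σ} {d : ℕ}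
    (hf : Decomp val Xs Good f W d) (a : K) : Decomp val Xs Good (a • f) W d := by
  obtain ⟨L, c, r, hf, hL, hr⟩ := hf
  refine ⟨L, fun u => a • c u, a • r, ?_, fun u hu => ⟨(hL u hu).1, (hL u hu).2.1,
    Subalgebra.smul_mem _ (hL u hu).2.2 a⟩, hr.smul a⟩
  rw [hf, smul_add, Finset.smul_sum]
  simp only [smul_mul_assoc]

/-- Multiplying a decomposition by a low-degree polynomial in fresh variables. [folklore] -/
theorem Decomp.mul {Good : ℕ → Prop} {f h : MvPolynomial σ K} {W₁ W₂ : Finset σ} {d e : ℕ}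
    (hf : Decomp val Xs Good f W₁ d) (hh : h ∈ supported K (↑W₂ : Set σ))
    (hdisj : Disjoint W₁ W₂) (he : MVanish h e) :
    Decomp val Xs Good (f * h) (W₁ ∪ W₂) (d + e) := by
  obtain ⟨L, c, r, hf, hL, hr⟩ := hf
  refine ⟨L, fun u => c u * h, r * h, ?_, fun u hu => ⟨(hL u hu).1,
    (hL u hu).2.1.trans Finset.subset_union_left, ?_⟩, hr.mul he⟩
  · rw [hf, add_mul, Finset.sum_mul]
    congr 1
    exact Finset.sum_congr rfl fun u _ => by ring
  · refine Subalgebra.mul_mem _ (hL u hu).2.2 (supported_mono ?_ hh)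
    intro x hx
    rw [Finset.mem_coe, Finset.mem_compl]
    exact fun hx' => Finset.disjoint_left.1 hdisj ((hL u hu).2.1 hx') hx

/-- The same with the factors swapped. [folklore] -/
theorem Decomp.mul_left {Good : ℕ → Prop} {f h : MvPolynomial σ K} {W₁ W₂ : Finset σ} {d e : ℕ}
    (hf : Decomp val Xs Good f W₁ d) (hh : h ∈ supported K (↑W₂ : Set σ))
    (hdisj : Disjoint W₁ W₂) (he : MVanish h e) :
    Decomp val Xs Good (h * f) (W₂ ∪ W₁) (e + d) := by
  rw [mul_comm, Finset.union_comm, add_comm]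
  exact hf.mul hh hdisj he

end Decomp



/-! ### The structure lemma: decomposing the values of high gates (RSY08 Prop. 5.5 / 5.8) -/

section Structure

open Literature.Computability.AlgebraicComplexity Literature.Computability.AlgebraicComplexity.ArithCircuit

variable {K : Type*} [Field K] {N : ℕ}

/-- `X_v`: the syntactic variable set of gate `v` of the gate list `G`. [cite: AlonKumarVolk2020, §2.2] -/
def XsG (G : List (Gate K (Fin N))) (v : ℕ) : Finset (Fin N) := (gateVarSets G).getD v ∅

/-- The value of gate `v` of `G`. [folklore] -/
def valG (G : List (Gate K (Fin N))) (v : ℕ) : MvPolynomial (Fin N) K := (gateValues G).getD v 0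

/-- **Upper region**: `|X_v| ≥ N - κ`. [cite: AlonKumarVolk2020, Def. 22] -/
def High (G : List (Gate K (Fin N))) (κ v : ℕ) : Prop := N ≤ (XsG G v).card + κ

/-- **Lower-leveled size**: `κ < |X_u| < N - κ`. [cite: AlonKumarVolk2020, Def. 22] -/
def Low (G : List (Gate K (Fin N))) (κ u : ℕ) : Prop := κ < (XsG G u).card ∧ (XsG G u).card + κ < N

/-- `u` has a high parent `p` hanging below `v` (`X_p ⊆ X_v`). [cite: AlonKumarVolk2020, Def. 22] -/
def HasHighParent (G : List (Gate K (Fin N))) (κ u v : ℕ) : Prop :=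
  ∃ (p : ℕ) (hp : p < G.length), High G κ p ∧ u < p ∧ Operand.gate u ∈ (G[p]).args ∧ XsG G p ⊆ XsG G v

/-- The lower-leveled gates relevant below `v`. [cite: AlonKumarVolk2020, Def. 22] -/
def GoodAt (G : List (Gate K (Fin N))) (κ v u : ℕ) : Prop := Low G κ u ∧ HasHighParent G κ u v

omit [Field K] in
/-- `HasHighParent` is monotone along `X_v ⊆ X_{v'}`. [folklore] -/
theorem HasHighParent.mono {G : List (Gate K (Fin N))} {κ u v v' : ℕ} (h : HasHighParent G κ u v)
    (hvv' : XsG G v ⊆ XsG G v') : HasHighParent G κ u v' := by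
  obtain ⟨p, hp, h1, h2, h3, h4⟩ := h
  exact ⟨p, hp, h1, h2, h3, h4.trans hvv'⟩

omit [Field K] in
/-- `GoodAt` is monotone along `X_v ⊆ X_{v'}`. [folklore] -/
theorem GoodAt.mono {G : List (Gate K (Fin N))} {κ u v v' : ℕ} (h : GoodAt G κ v u)
    (hvv' : XsG G v ⊆ XsG G v') : GoodAt G κ v' u :=
  ⟨h.1, h.2.mono hvv'⟩

variable (G : List (Gate K (Fin N)))

/-- The value of an operand of gate `v` lies in `K[its syntactic variable set]`. [folklore] -/
theorem operand_eval_mem_supported {v : ℕ} (hv : v ≤ G.length) (u : Operand K (Fin N)) :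
    u.eval (gateValues (G.take v)) ∈
      supported K (↑(operandVarSet (gateVarSets (G.take v)) u) : Set (Fin N)) := by
  cases u with
  | var x =>
    simp only [Operand.eval, operandVarSet, Finset.coe_singleton]
    exact Algebra.subset_adjoin (Set.mem_image_of_mem _ (Set.mem_singleton x))
  | const c =>
    simp only [Operand.eval, operandVarSet]
    exact Subalgebra.algebraMap_mem _ c
  | gate p =>
    simp only [Operand.eval_gate, operandVarSet]
    by_cases hp : p < v
    · rw [gateValues_take G hv, gateVarSets_take G hv, List.getD_eq_getElem?_getD,
        List.getD_eq_getElem?_getD, List.getElem?_take_of_lt hp, List.getElem?_take_of_lt hp,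
        ← List.getD_eq_getElem?_getD, ← List.getD_eq_getElem?_getD]
      exact gateValues_mem_supported G (lt_of_lt_of_le hp hv)
    · have h1 : (gateValues (G.take v)).getD p 0 = 0 := by
        apply List.getD_eq_default _ _
        rw [gateValues_length, List.length_take, min_eq_left hv]
        exact not_lt.1 hp
      rw [h1]
      exact Subalgebra.zero_mem _

/-- The value and the variable set of a gate-reference operand of gate `v`. [folklore] -/
theorem operand_gate_eq {v p : ℕ} (hv : v ≤ G.length) (hp : p < v) :
    (Operand.gate p : Operand K (Fin N)).eval (gateValues (G.take v)) = valG G p ∧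
      operandVarSet (gateVarSets (G.take v)) (Operand.gate p : Operand K (Fin N)) = XsG G p := by
  constructor
  · show (gateValues (G.take v)).getD p 0 = (gateValues G).getD p 0
    rw [gateValues_take G hv, List.getD_eq_getElem?_getD, List.getD_eq_getElem?_getD,
      List.getElem?_take_of_lt hp]
  · show (gateVarSets (G.take v)).getD p ∅ = (gateVarSets G).getD p ∅
    rw [gateVarSets_take G hv, List.getD_eq_getElem?_getD, List.getD_eq_getElem?_getD,
      List.getElem?_take_of_lt hp]

omit [Field K] in
/-- The variable set of a non-reference operand has at most one element; a junk reference has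
none. [folklore] -/
theorem card_operandVarSet_le_one (vs : List (Finset (Fin N))) (u : Operand K (Fin N))
    (hu : ∀ p, u = .gate p → vs.length ≤ p) : (operandVarSet vs u).card ≤ 1 := by
  cases u with
  | var x => simp [operandVarSet]
  | const c => simp [operandVarSet]
  | gate p =>
    simp only [operandVarSet]
    rw [List.getD_eq_default _ _ (hu p rfl)]
    simp

variable (κ : ℕ)

/-- Classification of an operand of a gate `v`: a reference to a high gate, a reference to a
lower-leveled gate, or an operand with at most `κ` variables. [cite: AlonKumarVolk2020, Def. 22] -/
theorem operand_trichotomy (hκ : 1 ≤ κ) {v : ℕ} (hv : v ≤ G.length) (u : Operand K (Fin N)) :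
    (∃ p, p < v ∧ u = .gate p ∧ High G κ p) ∨ (∃ p, p < v ∧ u = .gate p ∧ Low G κ p) ∨
      (operandVarSet (gateVarSets (G.take v)) u).card ≤ κ := by
  by_cases hg : ∃ p, p < v ∧ u = .gate p
  · obtain ⟨p, hp, rfl⟩ := hg
    by_cases h1 : High G κ p
    · exact Or.inl ⟨p, hp, rfl, h1⟩
    · by_cases h2 : κ < (XsG G p).card
      · refine Or.inr (Or.inl ⟨p, hp, rfl, h2, ?_⟩)
        unfold High at h1
        omega
      · refine Or.inr (Or.inr ?_)
        rw [(operand_gate_eq G hv hp).2]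
        omega
  · refine Or.inr (Or.inr ((card_operandVarSet_le_one _ u fun p hup => ?_).trans hκ))
    subst hup
    rw [RazYehudayoff.length_gateVarSets, List.length_take, min_eq_left hv]
    by_contra h
    exact hg ⟨p, not_le.1 h, rfl⟩

/-- **The structure lemma** (RSY08 Prop. 5.5 with the degree bound of Prop. 5.8, as used in
[AlonKumarVolk2020, Lemma 23]): in a fan-in-two syntactically multilinear gate list with
`3κ < N`, the value of every high gate `v` (`|X_v| ≥ N - κ`) is
`∑_{u ∈ L} c_u · h_u + rem`, where every `u ∈ L` is lower-leveled (`κ < |X_u| < N - κ`) with a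
high parent below `v`, `h_u` is the value of gate `u`, `c_u ∈ K[(X_u)ᶜ]`, and `rem` has no
multilinear monomial of degree `> 2κ - (N - |X_v|)`. [cite: AlonKumarVolk2020, §4 (proof of Lemma 23)] -/
theorem structure_lemma (hfan : ∀ g ∈ G, g.fanIn ≤ 2)
    (hsm : ∀ (i : ℕ) (args : List (Operand K (Fin N))), G[i]? = some (.prod args) →
      (args.map (operandVarSet (gateVarSets (G.take i)))).Pairwise Disjoint)
    (hκ : 3 * κ < N) (hκ1 : 1 ≤ κ) {v : ℕ} (hv : v < G.length) (hhigh : High G κ v) :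
    Decomp (valG G) (XsG G) (GoodAt G κ v) (valG G v) (XsG G v) (2 * κ + (XsG G v).card - N) := by
  induction v using Nat.strong_induction_on with
  | _ v ih =>
    -- the gate, its operand values and operand variable sets
    have hval : valG G v = (G[v]).eval (gateValues (G.take v)) := by rw [valG, getD_gateValues G hv]
    have hX : XsG G v = gateVarSet (gateVarSets (G.take v)) (G[v]) := by rw [XsG, getD_gateVarSets G hv]
    have hXN : (XsG G v).card ≤ N := (Finset.card_le_univ _).trans_eq (Fintype.card_fin N)
    unfold High at hhigh
    -- decomposition of each operand, generic degree
    have hsub : ∀ u ∈ (G[v]).args, operandVarSet (gateVarSets (G.take v)) u ⊆ XsG G v := fun u hu => by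
      rw [hX]; exact operandVarSet_subset_gateVarSet (gateVarSets (G.take v)) _ hu
    have hop : ∀ u ∈ (G[v]).args, Decomp (valG G) (XsG G) (GoodAt G κ v) (u.eval (gateValues (G.take v)))
        (operandVarSet (gateVarSets (G.take v)) u) (2 * κ + (XsG G v).card - N) := by
      intro u hu
      rcases operand_trichotomy G κ hκ1 hv.le u with ⟨p, hp, rfl, hhp⟩ | ⟨p, hp, rfl, hlp⟩ | hsmall
      · obtain ⟨e1, e2⟩ := operand_gate_eq G hv.le hp
        rw [e1, e2]
        have hpv : XsG G p ⊆ XsG G v := e2 ▸ hsub _ hu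
        refine (ih p hp (hp.trans hv) hhp).mono (fun u hgu => hgu.mono hpv) subset_rfl ?_
        have := Finset.card_le_card hpv
        omega
      · obtain ⟨e1, e2⟩ := operand_gate_eq G hv.le hp
        rw [e1, e2, ← one_mul (valG G p)]
        refine Decomp.single ⟨hlp, v, hv, hhigh, hp, hu, subset_rfl⟩ subset_rfl
          (Subalgebra.one_mem _) _
      · refine Decomp.of_mvanish _ ((MVanish.of_supported (operand_eval_mem_supported G hv.le u)
          hsmall).mono ?_)
        omega
    -- case analysis on the gate
    have hfanv := hfan _ (List.getElem_mem hv)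
    rcases hg : G[v] with args | args <;> rw [hg] at hval hX hsub hop hfanv
    · -- weighted sum gate
      rw [hval]
      rcases args with _ | ⟨a, _ | ⟨b, _ | ⟨c, l⟩⟩⟩
      · exfalso
        rw [hX] at hhigh
        simp [gateVarSet, Gate.args] at hhigh
        omega
      · simp only [Gate.eval, List.map_cons, List.map_nil, List.sum_cons, List.sum_nil, add_zero]
        exact ((hop a.2 (by simp [Gate.args])).smul a.1).mono (fun _ h => h)
          (hsub a.2 (by simp [Gate.args])) le_rfl
      · simp only [Gate.eval, List.map_cons, List.map_nil, List.sum_cons, List.sum_nil, add_zero]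
        exact (((hop a.2 (by simp [Gate.args])).smul a.1).mono (fun _ h => h)
          (hsub a.2 (by simp [Gate.args])) le_rfl).add
          (((hop b.2 (by simp [Gate.args])).smul b.1).mono (fun _ h => h)
          (hsub b.2 (by simp [Gate.args])) le_rfl)
      · exfalso
        simp [Gate.fanIn, Gate.args] at hfanv
    · -- product gate
      rw [hval]
      rcases args with _ | ⟨u, _ | ⟨w, _ | ⟨c, l⟩⟩⟩
      · exfalso
        rw [hX] at hhigh
        simp [gateVarSet, Gate.args] at hhigh
        omega
      · simp only [Gate.eval, List.map_cons, List.map_nil, List.prod_cons, List.prod_nil, mul_one]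
        exact (hop u (by simp [Gate.args])).mono (fun _ h => h) (hsub u (by simp [Gate.args])) le_rfl
      · simp only [Gate.eval, List.map_cons, List.map_nil, List.prod_cons, List.prod_nil, mul_one]
        have hdisj : Disjoint (operandVarSet (gateVarSets (G.take v)) u) (operandVarSet (gateVarSets (G.take v)) w) := by
          have := hsm v [u, w] (by rw [List.getElem?_eq_getElem hv, hg])
          simpa using this
        have hXuw : XsG G v = operandVarSet (gateVarSets (G.take v)) u ∪ operandVarSet (gateVarSets (G.take v)) w := by
          rw [hX, gateVarSet_prod_two]
        have hcard : (XsG G v).card = (operandVarSet (gateVarSets (G.take v)) u).card + (operandVarSet (gateVarSets (G.take v)) w).card := by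
          rw [hXuw, Finset.card_union_of_disjoint hdisj]
        have hu_mem : u ∈ (Gate.prod [u, w] : Gate K (Fin N)).args := by simp [Gate.args]
        have hw_mem : w ∈ (Gate.prod [u, w] : Gate K (Fin N)).args := by simp [Gate.args]
        rcases operand_trichotomy G κ hκ1 hv.le u with ⟨p, hp, rfl, hhp⟩ | ⟨p, hp, rfl, hlp⟩ | husmall
        · -- `u` refers to a high gate: `w` is tiny
          obtain ⟨e1, e2⟩ := operand_gate_eq G hv.le hp
          rw [e2] at hdisj hXuw hcard
          rw [e1]
          have hpv : XsG G p ⊆ XsG G v := e2 ▸ hsub _ hu_mem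
          have hD := (ih p hp (hp.trans hv) hhp).mono (fun u hgu => hgu.mono hpv) subset_rfl le_rfl
          have hprod := hD.mul (operand_eval_mem_supported G hv.le w) hdisj
            (MVanish.of_supported (operand_eval_mem_supported G hv.le w) le_rfl)
          refine hprod.mono (fun _ h => h) (by rw [hXuw]) ?_
          unfold High at hhp
          omega
        · -- `u` refers to a lower-leveled gate
          obtain ⟨e1, e2⟩ := operand_gate_eq G hv.le hp
          rw [e2] at hdisj
          rw [e1, mul_comm]
          refine Decomp.single ⟨hlp, v, hv, hhigh, hp, hg ▸ hu_mem, subset_rfl⟩ (e2 ▸ hsub _ hu_mem)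
            (supported_mono ?_ (operand_eval_mem_supported G hv.le w)) _
          intro x hx
          rw [Finset.mem_coe, Finset.mem_compl]
          exact fun hx' => Finset.disjoint_left.1 hdisj hx' hx
        · rcases operand_trichotomy G κ hκ1 hv.le w with ⟨p, hp, rfl, hhp⟩ | ⟨p, hp, rfl, hlp⟩ | hwsmall
          · -- `w` refers to a high gate
            obtain ⟨e1, e2⟩ := operand_gate_eq G hv.le hp
            rw [e2] at hdisj hXuw hcard
            rw [e1]
            have hpv : XsG G p ⊆ XsG G v := e2 ▸ hsub _ hw_mem
            have hD := (ih p hp (hp.trans hv) hhp).mono (fun u hgu => hgu.mono hpv) subset_rfl le_rfl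
            have hprod := hD.mul_left (operand_eval_mem_supported G hv.le u) hdisj.symm
              (MVanish.of_supported (operand_eval_mem_supported G hv.le u) le_rfl)
            refine hprod.mono (fun _ h => h) (by rw [hXuw]) ?_
            unfold High at hhp
            omega
          · -- `w` refers to a lower-leveled gate
            obtain ⟨e1, e2⟩ := operand_gate_eq G hv.le hp
            rw [e2] at hdisj
            rw [e1]
            refine Decomp.single ⟨hlp, v, hv, hhigh, hp, hg ▸ hw_mem, subset_rfl⟩ (e2 ▸ hsub _ hw_mem)
              (supported_mono ?_ (operand_eval_mem_supported G hv.le u)) _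
            intro x hx
            rw [Finset.mem_coe, Finset.mem_compl]
            exact fun hx' => Finset.disjoint_left.1 hdisj hx hx'
          · -- both operands small: impossible
            exfalso
            omega
      · exfalso
        simp [Gate.fanIn, Gate.args] at hfanv

end Structure



/-! ### Lemma 23 and the double counting (proof of [AlonKumarVolk2020, Thm. 20]) -/

section Lemma23

open Literature.Computability.AlgebraicComplexity Literature.Computability.AlgebraicComplexity.ArithCircuit

variable {K : Type*} [Field K]

/-- A balanced set meeting a given small set of positions in at most `n - 2` points. [folklore] -/
theorem exists_balanced_small_inter {n : ℕ} (hn : 2 ≤ n) (W : Finset (Fin (2 * n)))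
    (hW : W.card + 2 ≤ 2 * n) : ∃ Y : Finset (Fin (2 * n)), Y.card = n ∧ (Y ∩ W).card + 2 ≤ n := by
  classical
  have hWc : 2 ≤ Wᶜ.card := by
    rw [Finset.card_compl, Fintype.card_fin]; omega
  obtain ⟨a, ha, b, hb, hab⟩ := Finset.one_lt_card.1 (by omega : 1 < Wᶜ.card)
  rw [Finset.mem_compl] at ha hb
  obtain ⟨T, hT, hTcard⟩ := Finset.exists_subset_card_eq
    (show n - 2 ≤ (Finset.univ \ {a, b} : Finset (Fin (2 * n))).card by
      rw [Finset.card_sdiff_of_subset (Finset.subset_univ _), Finset.card_univ, Fintype.card_fin,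
        Finset.card_pair hab]; omega)
  have haT : a ∉ T := fun h => by have := hT h; simp at this
  have hbT : b ∉ T := fun h => by have := hT h; simp at this
  refine ⟨insert a (insert b T), ?_, ?_⟩
  · rw [Finset.card_insert_of_notMem (by simp [hab, haT]), Finset.card_insert_of_notMem hbT, hTcard]
    omega
  · have hsub : insert a (insert b T) ∩ W ⊆ T := by
      intro x hx
      rw [Finset.mem_inter, Finset.mem_insert, Finset.mem_insert] at hx
      rcases hx with ⟨rfl | rfl | hx, hxW⟩
      · exact absurd hxW ha
      · exact absurd hxW hb
      · exact hx
    have := Finset.card_le_card hsub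
    omega

/-- Rank bound from the multilinear degree: `rank M_{Y,Z}(f) ≤ #{P ⊆ Y : |P| ≤ d}` if `f` has no
multilinear monomial of degree `> d`. [cite: AlonKumarVolk2020, Prop. 8 (5)] -/
theorem rank_cm_le_of_mvanish {N : ℕ} {f : MvPolynomial (Fin N) K} {d : ℕ} (hf : MVanish f d)
    (Y Z : Finset (Fin N)) : (cm f Y Z).rank ≤ (Y.powerset.filter (fun P => P.card ≤ d)).card := by
  classical
  refine rank_le_card_of_rows _ _ fun P hP Q => ?_
  rw [Finset.mem_filter, Finset.mem_powerset] at hP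
  simp only [cm_apply]
  split_ifs with h
  · apply hf
    have hPd : d < P.card := by
      by_contra h'
      exact hP ⟨h.1, not_lt.1 h'⟩
    exact hPd.trans_le (Finset.card_le_card Finset.subset_union_left)
  · rfl

/-- **A low-support polynomial is not the derivative of a full-rank polynomial**: if
`∂g/∂x ∈ K[W]` with `|W| ≤ 2n - 2` then `g` is not of full rank. [cite: AlonKumarVolk2020, §4 (proof of Thm. 20)] -/
theorem not_supported_small {n : ℕ} (hn : 2 ≤ n) {g : MvPolynomial (Fin (2 * n)) K}
    (hg : IsFullRank n g) (x : Fin (2 * n)) {W : Finset (Fin (2 * n))} (hW : W.card + 2 ≤ 2 * n)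
    (hsupp : MvPolynomial.pderiv x g ∈ MvPolynomial.supported K (↑W : Set (Fin (2 * n)))) : False := by
  classical
  obtain ⟨Y, hY, hYW⟩ := exists_balanced_small_inter hn W hW
  have h1 := rank_cm_pderiv_ge_of_isFullRank hg Y hY x
  have h2 := rank_cm_le_pow_of_supported hsupp Y Yᶜ
  have h3 : 2 ^ (Y ∩ W).card < 2 ^ (n - 1) := Nat.pow_lt_pow_right (by norm_num) (by omega)
  omega

/-- The gate indices among the operands of a gate. [folklore] -/
def gateIdx : Operand K σ → Option ℕ
  | .gate j => some j
  | _ => none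

/-- The children (gate indices referred to) of gate `p` of `G`. [folklore] -/
def children {N : ℕ} (G : List (Gate K (Fin N))) (p : ℕ) : Finset ℕ :=
  ((G.getD p (.prod [])).args.filterMap gateIdx).toFinset

omit [Field K] in
/-- A gate operand is a child. [folklore] -/
theorem mem_children {N : ℕ} (G : List (Gate K (Fin N))) {p : ℕ} (hp : p < G.length) {u : ℕ}
    (hu : Operand.gate u ∈ (G[p]).args) : u ∈ children G p := by
  unfold children
  rw [List.getD_eq_getElem?_getD, List.getElem?_eq_getElem hp, Option.getD_some, List.mem_toFinset,
    List.mem_filterMap]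
  exact ⟨_, hu, rfl⟩

omit [Field K] in
/-- A fan-in-two gate has at most two children. [folklore] -/
theorem card_children_le {N : ℕ} (G : List (Gate K (Fin N))) (hfan : ∀ g ∈ G, g.fanIn ≤ 2) (p : ℕ) :
    (children G p).card ≤ 2 := by
  unfold children
  refine (List.toFinset_card_le _).trans ((List.length_filterMap_le _ _).trans ?_)
  rw [List.getD_eq_getElem?_getD]
  by_cases hp : p < G.length
  · rw [List.getElem?_eq_getElem hp, Option.getD_some]
    exact hfan _ (List.getElem_mem hp)
  · rw [List.getElem?_eq_none (not_lt.1 hp)]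
    simp [Gate.args]

variable {n : ℕ} (τ : ℕ)

/-- The threshold `κ = 352 (τ + 8)` separating "tiny", "lower-leveled" and "upper" gates
(AKV: `100 τ`, `τ = 3 log n`). [cite: AlonKumarVolk2020, Lemma 23] -/
def kap : ℕ := 352 * (τ + 8)

/-- **[AlonKumarVolk2020, Lemma 23] for one output of `Ψ'`.** In the derivative gate list of
a normalized fan-in-two syntactically multilinear circuit for a full-rank `g`, the output
computing `∂g/∂x` is a high gate `o` and every decomposition set of lower-leveled gates below
it is large: `16 τ |L| ≥ N`. [cite: AlonKumarVolk2020, Lemma 23] -/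
theorem lemma23 (hn : 2 ≤ n) (hτ : 2 ≤ τ) (h2τ : 2 * τ ≤ n) (hNτ : 2 * n ≤ 2 ^ τ)
    (hκN : 3 * kap τ < 2 * n) (hlarge : (2 * kap τ + 1) * n ^ (2 * kap τ) ≤ 2 ^ (n - 2))
    {g : MvPolynomial (Fin (2 * n)) K} (hg : IsFullRank n g) {P : ArithCircuit K (Fin (2 * n))}
    (h2 : P.IsFanInTwo) (hsm : IsSyntacticallyMultilinear P) (hs : 0 < P.size)
    (hout : P.output = .gate (P.size - 1)) (hP : P.Computes g) (x : Fin (2 * n)) :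
    ∃ (o : ℕ) (_ : o < (derivGates P.gates).length), derivOut P.gates x = .gate o ∧
      High (derivGates P.gates) (kap τ) o ∧
      ∃ L : Finset ℕ, 2 * n ≤ 16 * τ * L.card ∧ ∀ u ∈ L, GoodAt (derivGates P.gates) (kap τ) o u := by
  classical
  set Dg := derivGates P.gates with hDg
  have hκ1 : 1 ≤ kap τ := by unfold kap; omega
  have hfx : (derivOut P.gates x).eval (gateValues Dg) = MvPolynomial.pderiv x g := by
    have := derivCircuit_eval h2 hs hout x
    rw [hP] at this
    exact this
  have hfanD : ∀ g' ∈ Dg, g'.fanIn ≤ 2 := derivGates_fanIn P.gates h2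
  have hsmD := fun i args hi => derivGates_sm (gs := P.gates) hsm i args hi
  -- the output is a gate reference
  have hsmall : ∀ W : Finset (Fin (2 * n)), W.card + 2 ≤ 2 * n →
      MvPolynomial.pderiv x g ∈ MvPolynomial.supported K (↑W : Set (Fin (2 * n))) → False :=
    fun W hW hsupp => not_supported_small hn hg x hW hsupp
  rcases hox : derivOut P.gates x with y | c | o
  · exfalso
    refine hsmall {y} (by simp; omega) ?_
    rw [← hfx, hox]
    simp only [Operand.eval, Finset.coe_singleton]
    exact Algebra.subset_adjoin (Set.mem_image_of_mem _ (Set.mem_singleton y))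
  · exfalso
    refine hsmall ∅ (by simp; omega) ?_
    rw [← hfx, hox]
    simp only [Operand.eval]
    exact Subalgebra.algebraMap_mem _ c
  · have ho : o < Dg.length := by
      have := derivOut_refsBelow P.gates x
      rw [hox] at this
      exact this
    have hval : MvPolynomial.pderiv x g = valG Dg o := by
      rw [← hfx, hox]; rfl
    have hsuppo : valG Dg o ∈ MvPolynomial.supported K (↑(XsG Dg o) : Set (Fin (2 * n))) :=
      gateValues_mem_supported Dg ho
    -- the output gate is high
    have hhigh : High Dg (kap τ) o := by
      by_contra hh
      unfold High at hh
      exact hsmall (XsG Dg o) (by omega) (hval ▸ hsuppo)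
    refine ⟨o, ho, rfl, hhigh, ?_⟩
    -- the decomposition of the output value
    obtain ⟨L, c, rem, hdec, hL, hrem⟩ :=
      structure_lemma Dg (kap τ) hfanD hsmD hκN hκ1 ho hhigh
    refine ⟨L, ?_, fun u hu => (hL u hu).1⟩
    by_contra hfew
    push Not at hfew
    -- unbalance all the `X_u`, `u ∈ L`
    obtain ⟨Y, hYN, hYun⟩ := exists_balanced_unbalancing τ (N := 2 * n) (even_two_mul n)
      (L.image (XsG Dg)) (fun S hS => by
        obtain ⟨u, hu, rfl⟩ := Finset.mem_image.1 hS
        have hlow := (hL u hu).1.1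
        unfold Low kap at hlow
        omega) hNτ (lt_of_le_of_lt (Nat.mul_le_mul_left _ Finset.card_image_le) hfew)
    have hY : Y.card = n := by omega
    have hYc : Yᶜ.card = n := by rw [Finset.card_compl, Fintype.card_fin, hY]; omega
    -- rank lower bound
    have hlow := rank_cm_pderiv_ge_of_isFullRank hg Y hY x
    rw [hval, hdec] at hlow
    -- rank upper bound
    have hLlt : L.card < 2 ^ τ := by
      have : L.card ≤ 16 * τ * L.card := Nat.le_mul_of_pos_left _ (by omega)
      omega
    have hterm : ∀ u ∈ L, (cm (c u * valG Dg u) Y Yᶜ).rank ≤ 2 ^ (n - 2 * τ) := by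
      intro u hu
      obtain ⟨⟨hlowu, p, hp, -, hup, -, -⟩, -, hcu⟩ := hL u hu
      have hu' : u < Dg.length := hup.trans hp
      refine rank_cm_mul_le_of_unbalanced (XsG Dg u) hcu (gateValues_mem_supported Dg hu') Y hY hYc ?_
      have := hYun (XsG Dg u) (Finset.mem_image_of_mem _ hu)
      push_cast
      exact this
    have hremrank : (cm rem Y Yᶜ).rank ≤ 2 ^ (n - 2) := by
      refine (rank_cm_le_of_mvanish hrem Y Yᶜ).trans ((card_powerset_filter_card_le Y _ (by omega)).trans ?_)
      rw [hY]
      refine le_trans ?_ hlarge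
      have hd : 2 * kap τ + (XsG Dg o).card - 2 * n ≤ 2 * kap τ := by
        have := (Finset.card_le_univ (XsG Dg o)).trans_eq (Fintype.card_fin (2 * n))
        omega
      exact Nat.mul_le_mul (by omega) (Nat.pow_le_pow_right (by omega) hd)
    have hup : (cm (∑ u ∈ L, c u * valG Dg u + rem) Y Yᶜ).rank < 2 ^ (n - 1) := by
      calc (cm (∑ u ∈ L, c u * valG Dg u + rem) Y Yᶜ).rank
          ≤ (cm (∑ u ∈ L, c u * valG Dg u) Y Yᶜ).rank + (cm rem Y Yᶜ).rank := rank_cm_add_le _ _ _ _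
        _ ≤ ∑ u ∈ L, (cm (c u * valG Dg u) Y Yᶜ).rank + 2 ^ (n - 2) :=
            Nat.add_le_add (rank_cm_sum_le _ _ _ _) hremrank
        _ ≤ L.card * 2 ^ (n - 2 * τ) + 2 ^ (n - 2) := by
            refine Nat.add_le_add_right ?_ _
            have := Finset.sum_le_card_nsmul _ _ _ hterm
            rwa [smul_eq_mul] at this
        _ < 2 ^ τ * 2 ^ (n - 2 * τ) + 2 ^ (n - 2) := by
            refine Nat.add_lt_add_right ?_ _
            exact (Nat.mul_lt_mul_right (pow_pos (by norm_num) _)).2 hLlt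
        _ = 2 ^ (n - τ) + 2 ^ (n - 2) := by
            rw [← pow_add, show τ + (n - 2 * τ) = n - τ by omega]
        _ ≤ 2 ^ (n - 2) + 2 ^ (n - 2) :=
            Nat.add_le_add_right (Nat.pow_le_pow_right (by norm_num) (by omega)) _
        _ = 2 ^ (n - 1) := by
            rw [← two_mul, ← pow_succ', show n - 2 + 1 = n - 1 by omega]
    exact absurd hlow (not_le.2 hup)

/-- **The double counting of [AlonKumarVolk2020, proof of Thm. 20]**: for a normalized
fan-in-two syntactically multilinear circuit of size `s` computing a full-rank `g` (in the
large-`n` regime), `N² ≤ 160 τ κ s`. [cite: AlonKumarVolk2020, Thm. 20 (proof)] -/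
theorem size_bound_core (hn : 2 ≤ n) (hτ : 2 ≤ τ) (h2τ : 2 * τ ≤ n) (hNτ : 2 * n ≤ 2 ^ τ)
    (hκN : 3 * kap τ < 2 * n) (hlarge : (2 * kap τ + 1) * n ^ (2 * kap τ) ≤ 2 ^ (n - 2))
    {g : MvPolynomial (Fin (2 * n)) K} (hg : IsFullRank n g) {P : ArithCircuit K (Fin (2 * n))}
    (h2 : P.IsFanInTwo) (hsm : IsSyntacticallyMultilinear P) (hs : 0 < P.size)
    (hout : P.output = .gate (P.size - 1)) (hP : P.Computes g) :
    (2 * n) * (2 * n) ≤ 160 * τ * kap τ * P.size := by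
  classical
  set Dg := derivGates P.gates with hDg
  set κ := kap τ with hκ
  have hfanD : ∀ g' ∈ Dg, g'.fanIn ≤ 2 := derivGates_fanIn P.gates h2
  have hsmD := fun i args hi => derivGates_sm (gs := P.gates) hsm i args hi
  -- per output
  have key := fun x => lemma23 τ hn hτ h2τ hNτ hκN hlarge hg h2 hsm hs hout hP x
  choose o ho hox hhigh L hL hgood using key
  -- the high gates avoiding `x`
  let HM : Fin (2 * n) → Finset ℕ := fun x =>
    (Finset.range Dg.length).filter (fun p => 2 * n ≤ (XsG Dg p).card + κ ∧ x ∉ XsG Dg p)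
  -- `L x` sits among the children of `HM x`
  have hLsub : ∀ x, L x ⊆ (HM x).biUnion (children Dg) := by
    intro x u hu
    obtain ⟨-, p, hp, hhp, hup, hmem, hpo⟩ := hgood x u hu
    rw [Finset.mem_biUnion]
    refine ⟨p, ?_, mem_children Dg hp hmem⟩
    simp only [HM, Finset.mem_filter, Finset.mem_range]
    refine ⟨hp, hhp, fun hx => ?_⟩
    have hxo : x ∉ XsG Dg (o x) := by
      have := not_mem_operandVarSet_derivOut (gs := P.gates) hsm x
      rw [hox x] at this
      exact this
    exact hxo (hpo hx)
  have hLcard : ∀ x, (L x).card ≤ 2 * (HM x).card := by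
    intro x
    calc (L x).card ≤ ((HM x).biUnion (children Dg)).card := Finset.card_le_card (hLsub x)
      _ ≤ ∑ p ∈ HM x, (children Dg p).card := Finset.card_biUnion_le
      _ ≤ ∑ _p ∈ HM x, 2 := Finset.sum_le_sum fun p _ => card_children_le Dg hfanD p
      _ = 2 * (HM x).card := by rw [Finset.sum_const, smul_eq_mul, mul_comm]
  -- double counting of `∑_x |HM x|`
  have hHM : ∑ x, (HM x).card ≤ κ * Dg.length := by
    let HA : Finset ℕ := (Finset.range Dg.length).filter (fun p => 2 * n ≤ (XsG Dg p).card + κ)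
    have h1 : ∀ x, (HM x).card = ∑ p ∈ HA, (if x ∉ XsG Dg p then 1 else 0) := by
      intro x
      rw [Finset.card_eq_sum_ones, Finset.sum_filter, Finset.sum_filter]
      refine Finset.sum_congr rfl fun p _ => ?_
      by_cases ha : 2 * n ≤ (XsG Dg p).card + κ
      · simp [ha]
      · simp [ha]
    calc ∑ x, (HM x).card = ∑ x, ∑ p ∈ HA, (if x ∉ XsG Dg p then 1 else 0) := by
          simp only [h1]
      _ = ∑ p ∈ HA, ∑ x, (if x ∉ XsG Dg p then 1 else 0) := Finset.sum_comm
      _ = ∑ p ∈ HA, ((XsG Dg p)ᶜ).card := by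
          refine Finset.sum_congr rfl fun p _ => ?_
          rw [Finset.card_eq_sum_ones, Finset.sum_ite, Finset.sum_const_zero, add_zero,
            Finset.sum_const, smul_eq_mul, mul_one, Finset.card_eq_sum_ones]
          congr 1
          ext y
          simp
      _ ≤ ∑ _p ∈ HA, κ := by
          refine Finset.sum_le_sum fun p hp => ?_
          rw [Finset.mem_filter] at hp
          rw [Finset.card_compl, Fintype.card_fin]
          omega
      _ = κ * HA.card := by rw [Finset.sum_const, smul_eq_mul, mul_comm]
      _ ≤ κ * Dg.length := by
          refine Nat.mul_le_mul_left _ ?_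
          exact (Finset.card_filter_le _ _).trans (by rw [Finset.card_range])
  -- assemble
  have hsum : ∑ x : Fin (2 * n), 2 * n ≤ ∑ x : Fin (2 * n), 16 * τ * (L x).card :=
    Finset.sum_le_sum fun x _ => hL x
  rw [Finset.sum_const, smul_eq_mul, Finset.card_univ, Fintype.card_fin] at hsum
  have hDlen : Dg.length ≤ 5 * P.size := derivGates_length_le P.gates
  calc (2 * n) * (2 * n) ≤ ∑ x : Fin (2 * n), 16 * τ * (L x).card := hsum
    _ ≤ ∑ x : Fin (2 * n), 16 * τ * (2 * (HM x).card) :=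
        Finset.sum_le_sum fun x _ => Nat.mul_le_mul_left _ (hLcard x)
    _ = 32 * τ * ∑ x : Fin (2 * n), (HM x).card := by
        rw [Finset.mul_sum]
        exact Finset.sum_congr rfl fun x _ => by ring
    _ ≤ 32 * τ * (κ * Dg.length) := Nat.mul_le_mul_left _ hHM
    _ ≤ 32 * τ * (κ * (5 * P.size)) := Nat.mul_le_mul_left _ (Nat.mul_le_mul_left _ hDlen)
    _ = 160 * τ * κ * P.size := by ring

end Lemma23



/-! ### Normalization, asymptotics, and Theorem 20 -/

section Final

open Literature.Computability.AlgebraicComplexity Literature.Computability.AlgebraicComplexity.ArithCircuit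

variable {K : Type*} [Field K] {n : ℕ}

/-- A full-rank polynomial is not a polynomial in fewer than `n` of its `2n` variables. [cite: AlonKumarVolk2020, §4] -/
theorem isFullRank_not_supported (hn : 1 ≤ n) {g : MvPolynomial (Fin (2 * n)) K} (hg : IsFullRank n g)
    {W : Finset (Fin (2 * n))} (hW : W.card < n)
    (hsupp : g ∈ MvPolynomial.supported K (↑W : Set (Fin (2 * n)))) : False := by
  classical
  obtain ⟨Y, -, hY⟩ := Finset.exists_subset_card_eq
    (show n ≤ (Finset.univ : Finset (Fin (2 * n))).card by
      rw [Finset.card_univ, Fintype.card_fin]; omega)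
  obtain ⟨A, hYA, hZA⟩ := exists_equiv_of_balanced Y hY
  have hfull : (cm g Y Yᶜ).rank = 2 ^ n := by
    rw [← hZA, ← hYA, ← rank_pdMatrix_rename]
    exact hg A
  have h2 := rank_cm_le_pow_of_supported hsupp Y Yᶜ
  have h3 : 2 ^ (Y ∩ W).card < 2 ^ n :=
    Nat.pow_lt_pow_right (by norm_num)
      (lt_of_le_of_lt (Finset.card_le_card Finset.inter_subset_right) hW)
  omega

/-- **Normalization**: a fan-in-two syntactically multilinear circuit computing a full-rank
polynomial can be cut down to one whose output is its last gate. [folklore] -/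
theorem exists_normalized (hn : 2 ≤ n) {g : MvPolynomial (Fin (2 * n)) K} (hg : IsFullRank n g)
    {P : ArithCircuit K (Fin (2 * n))} (h2 : P.IsFanInTwo) (hsm : IsSyntacticallyMultilinear P)
    (hP : P.Computes g) :
    ∃ P' : ArithCircuit K (Fin (2 * n)), P'.IsFanInTwo ∧ IsSyntacticallyMultilinear P' ∧
      0 < P'.size ∧ P'.output = .gate (P'.size - 1) ∧ P'.Computes g ∧ P'.size ≤ P.size := by
  have hev : g = P.output.eval (gateValues P.gates) := hP.symm
  rcases hout : P.output with y | c | o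
  · exfalso
    refine isFullRank_not_supported (by omega) hg (W := {y}) (by simp; omega) ?_
    rw [hev, hout]
    simp only [Operand.eval, Finset.coe_singleton]
    exact Algebra.subset_adjoin (Set.mem_image_of_mem _ (Set.mem_singleton y))
  · exfalso
    refine isFullRank_not_supported (by omega) hg (W := ∅) (by simp; omega) ?_
    rw [hev, hout]
    exact Subalgebra.algebraMap_mem _ c
  · by_cases ho : o < P.gates.length
    · refine ⟨⟨P.gates.take (o + 1), .gate o⟩, fun g' hg' => h2 g' (List.mem_of_mem_take hg'),
        fun i args hi => ?_, by simp [ArithCircuit.size]; omega, ?_, ?_, ?_⟩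
      · have hi' : i < o + 1 := by
          by_contra h
          rw [List.getElem?_eq_none (by simp; omega)] at hi
          cases hi
        simp only at hi ⊢
        rw [List.getElem?_take_of_lt hi'] at hi
        rw [List.take_take, min_eq_left hi'.le]
        exact hsm i args hi
      · simp only [ArithCircuit.size, List.length_take]
        congr 1
        omega
      · show (Operand.gate o : Operand K (Fin (2 * n))).eval (gateValues (P.gates.take (o + 1))) = g
        rw [hev, hout, Operand.eval_gate, Operand.eval_gate, gateValues_take _ (by omega),
          List.getD_eq_getElem?_getD, List.getD_eq_getElem?_getD, List.getElem?_take_of_lt (by omega)]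
      · simp only [ArithCircuit.size, List.length_take]
        omega
    · exfalso
      refine isFullRank_not_supported (by omega) hg (W := ∅) (by simp; omega) ?_
      rw [hev, hout, Operand.eval_gate, List.getD_eq_default _ _ (by rw [gateValues_length]; omega)]
      exact Subalgebra.zero_mem _

/-- A circuit computing a full-rank polynomial has at least one gate. [folklore] -/
theorem one_le_size (hn : 2 ≤ n) {g : MvPolynomial (Fin (2 * n)) K} (hg : IsFullRank n g)
    {P : ArithCircuit K (Fin (2 * n))} (h2 : P.IsFanInTwo) (hsm : IsSyntacticallyMultilinear P)
    (hP : P.Computes g) : 1 ≤ P.size := by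
  obtain ⟨P', -, -, hs, -, -, hle⟩ := exists_normalized hn hg h2 hsm hP
  omega

/-! #### The parameters `τ = ⌊log₂ (2n)⌋ + 1`, `κ = 352 (τ + 8)` and the large-`n` regime -/

/-- `τ_n = ⌊log₂ (2n)⌋ + 1`, so that `2n < 2^{τ_n}`. [cite: AlonKumarVolk2020, Lemma 23 (`τ = 3 log n`)] -/
def tauN (n : ℕ) : ℕ := Nat.log 2 (2 * n) + 1

omit [Field K] in
/-- `2n ≤ 2^τ`. [folklore] -/
theorem two_mul_le_pow_tauN (n : ℕ) : 2 * n ≤ 2 ^ tauN n :=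
  (Nat.lt_pow_succ_log_self (by norm_num) (2 * n)).le

omit [Field K] in
/-- `τ ≥ 2` for `n ≥ 2`. [folklore] -/
theorem two_le_tauN (hn : 2 ≤ n) : 2 ≤ tauN n := by
  unfold tauN
  have : 1 ≤ Nat.log 2 (2 * n) := Nat.le_log_of_pow_le (by norm_num) (by omega)
  omega

omit [Field K] in
/-- `τ ≤ 4 log n` for `n ≥ 3`. [folklore] -/
theorem tauN_le_log (hn : 3 ≤ n) : (tauN n : ℝ) ≤ 4 * Real.log n := by
  have hlog2 := Real.log_two_gt_d9
  have hn0 : (0 : ℝ) < n := by exact_mod_cast (show 0 < n by omega)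
  have hl1 : 1 ≤ Real.log n := by
    rw [Real.le_log_iff_exp_le hn0]
    exact Real.exp_one_lt_three.le.trans (by exact_mod_cast hn)
  have hpow : (2 : ℝ) ^ Nat.log 2 (2 * n) ≤ 2 * n := by
    exact_mod_cast Nat.pow_log_le_self 2 (show 2 * n ≠ 0 by omega)
  have hlogpow := Real.log_le_log (by positivity) hpow
  rw [Real.log_pow, Real.log_mul (by norm_num) hn0.ne'] at hlogpow
  have hτ : (tauN n : ℝ) = (Nat.log 2 (2 * n) : ℝ) + 1 := by simp [tauN]
  rw [hτ]
  -- `L log 2 ≤ log 2 + log n` gives `L ≤ 1 + log n / log 2 ≤ 1 + 2 log n`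
  have hL : (Nat.log 2 (2 * n) : ℝ) ≤ 1 + 2 * Real.log n := by
    by_contra h
    push Not at h
    nlinarith
  linarith

omit [Field K] in
/-- **The large-`n` regime.** If `34000 (log n)² ≤ n` (and `n ≥ 3`) then, with
`τ = τ_n`, `κ = 352(τ+8)`: `3κ < 2n`, `2τ ≤ n` and `(2κ+1) n^{2κ} ≤ 2^{n-2}`. [folklore] -/
theorem large_regime (hn : 3 ≤ n) (hC : 34000 * Real.log n ^ 2 ≤ n) :
    3 * kap (tauN n) < 2 * n ∧ 2 * tauN n ≤ n ∧
      (2 * kap (tauN n) + 1) * n ^ (2 * kap (tauN n)) ≤ 2 ^ (n - 2) := by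
  have hlog2 := Real.log_two_gt_d9
  have hn0 : (0 : ℝ) < n := by exact_mod_cast (show 0 < n by omega)
  have hl1 : 1 ≤ Real.log n := by
    rw [Real.le_log_iff_exp_le hn0]
    exact Real.exp_one_lt_three.le.trans (by exact_mod_cast hn)
  have hτ := tauN_le_log hn
  set ℓ := Real.log n with hℓ
  have hκ : (kap (tauN n) : ℝ) ≤ 4224 * ℓ := by
    have : (kap (tauN n) : ℝ) = 352 * ((tauN n : ℝ) + 8) := by simp [kap]
    rw [this]; nlinarith
  have hκ0 : (0 : ℝ) ≤ kap (tauN n) := Nat.cast_nonneg _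
  have hl2 : ℓ ≤ ℓ ^ 2 := by nlinarith
  refine ⟨?_, ?_, ?_⟩
  · have : (3 * kap (tauN n) : ℝ) < 2 * n := by nlinarith
    exact_mod_cast this
  · have : (2 * tauN n : ℝ) ≤ n := by nlinarith
    exact_mod_cast this
  · -- compare logarithms
    have hn2 : 2 ≤ n := by omega
    have hlhs : Real.log (((2 * kap (tauN n) + 1 : ℕ) : ℝ) * (n : ℝ) ^ (2 * kap (tauN n))) ≤
        (n - 2 : ℕ) * Real.log 2 := by
      rw [Real.log_mul (by positivity) (by positivity), Real.log_pow]
      have h1 : Real.log ((2 * kap (tauN n) + 1 : ℕ) : ℝ) ≤ (2 * kap (tauN n) + 1 : ℕ) := by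
        have := Real.log_le_sub_one_of_pos (show (0 : ℝ) < ((2 * kap (tauN n) + 1 : ℕ) : ℝ) by positivity)
        linarith
      have h2 : ((2 * kap (tauN n) + 1 : ℕ) : ℝ) ≤ 8449 * ℓ := by push_cast; nlinarith
      have h3 : ((2 * kap (tauN n) : ℕ) : ℝ) * ℓ ≤ 8448 * ℓ ^ 2 := by push_cast; nlinarith
      have h4 : ((n - 2 : ℕ) : ℝ) = n - 2 := by push_cast [Nat.cast_sub hn2]; ring
      rw [h4]
      nlinarith
    have hpos : (0 : ℝ) < ((2 * kap (tauN n) + 1 : ℕ) : ℝ) * (n : ℝ) ^ (2 * kap (tauN n)) := by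
      positivity
    rw [← Real.log_pow, Real.log_le_log_iff hpos (by positivity)] at hlhs
    exact_mod_cast hlhs

omit [Field K] in
/-- Eventually `34000 (log n)² ≤ n`. [folklore] -/
theorem exists_large : ∃ n₀ : ℕ, 3 ≤ n₀ ∧ ∀ n : ℕ, n₀ ≤ n → 34000 * Real.log n ^ 2 ≤ n := by
  have h := (Real.isLittleO_pow_log_id_atTop (n := 2)).bound (show (0 : ℝ) < 1 / 34000 by norm_num)
  rw [Filter.eventually_atTop] at h
  obtain ⟨x₀, hx₀⟩ := h
  refine ⟨max 3 ⌈x₀⌉₊, le_max_left _ _, fun n hn => ?_⟩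
  have hnx : x₀ ≤ n := (Nat.le_ceil x₀).trans (by exact_mod_cast (le_max_right _ _).trans hn)
  have := hx₀ n hnx
  rw [Real.norm_eq_abs, Real.norm_eq_abs, abs_of_nonneg (by positivity), id,
    abs_of_nonneg (by positivity)] at this
  linarith

/-- **The real form of the size bound** in the large regime:
`size ≥ n² / (675840 (log n)²)`. [cite: AlonKumarVolk2020, Thm. 20] -/
theorem size_real_bound (hn : 3 ≤ n) {s : ℕ} (hs : (2 * n) * (2 * n) ≤ 160 * tauN n * kap (tauN n) * s) :
    (n : ℝ) ^ 2 / (675840 * Real.log n ^ 2) ≤ s := by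
  have hn0 : (0 : ℝ) < n := by exact_mod_cast (show 0 < n by omega)
  have hl1 : 1 ≤ Real.log n := by
    rw [Real.le_log_iff_exp_le hn0]
    exact Real.exp_one_lt_three.le.trans (by exact_mod_cast hn)
  have hτ := tauN_le_log hn
  have hτ0 : (0 : ℝ) ≤ tauN n := Nat.cast_nonneg _
  have hκ : (kap (tauN n) : ℝ) ≤ 4224 * Real.log n := by
    have : (kap (tauN n) : ℝ) = 352 * ((tauN n : ℝ) + 8) := by simp [kap]
    rw [this]; nlinarith
  have hsR : (4 : ℝ) * n ^ 2 ≤ 160 * tauN n * kap (tauN n) * s := by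
    have h' : ((2 * n * (2 * n) : ℕ) : ℝ) ≤ ((160 * tauN n * kap (tauN n) * s : ℕ) : ℝ) := by
      exact_mod_cast hs
    push_cast at h'
    nlinarith
  have hs0 : (0 : ℝ) ≤ s := Nat.cast_nonneg _
  have hprod : (160 : ℝ) * tauN n * kap (tauN n) ≤ 2703360 * Real.log n ^ 2 := by nlinarith
  rw [div_le_iff₀ (by positivity)]
  nlinarith

/-! #### Theorem 20 -/

/-- **[AlonKumarVolk2020, Thm. 20], combinatorial core in the large regime.** [cite: AlonKumarVolk2020, Thm. 20] -/
theorem size_bound (hn : 3 ≤ n) (hC : 34000 * Real.log n ^ 2 ≤ n) {g : MvPolynomial (Fin (2 * n)) K}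
    (hg : IsFullRank n g) {P : ArithCircuit K (Fin (2 * n))} (h2 : P.IsFanInTwo)
    (hsm : IsSyntacticallyMultilinear P) (hP : P.Computes g) :
    (n : ℝ) ^ 2 / (675840 * Real.log n ^ 2) ≤ P.size := by
  obtain ⟨P', h2', hsm', hs', hout', hP', hle⟩ := exists_normalized (by omega) hg h2 hsm hP
  obtain ⟨hκN, h2τ, hlarge⟩ := large_regime hn hC
  have hcore := size_bound_core (tauN n) (by omega) (two_le_tauN (by omega)) h2τ
    (two_mul_le_pow_tauN n) hκN hlarge hg h2' hsm' hs' hout' hP'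
  exact (size_real_bound hn hcore).trans (by exact_mod_cast hle)

end Final

end Literature.Barriers.ValiantsHypothesis.AKV

namespace Literature.Barriers.ValiantsHypothesis

universe u

open AKV Literature.Computability.AlgebraicComplexity Literature.Computability.AlgebraicComplexity.ArithCircuit in
/-- **Alon–Kumar–Volk 2020, Theorem 20 (proved).** There is `c > 0` such that for every field
`K`, every `n ≥ 2`, every full-rank `g ∈ K[x_1, …, x_{2n}]` and every fan-in-two syntactically
multilinear circuit `P` computing `g`, `|P| ≥ c n²/log² n`. Discharges the named fact
`AlonKumarVolk2020_thm20`. The proof follows [AlonKumarVolk2020, §4]: multilinear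
Baur–Strassen (`AKV.derivCircuit_eval`, Thm. 21), the structure lemma and Lemma 23
(`AKV.structure_lemma`, `AKV.lemma23`) with the unbalancing theorem
(`AKV.exists_balanced_unbalancing`, of the strength of Thm. 13, through an elementary Hegedűs
lemma) and the rank calculus of Prop. 8 (`AKV.rank_cm_*`), and the double counting of the
proof of Thm. 20 (`AKV.size_bound_core`); small `n` are absorbed in the constant.
[cite: AlonKumarVolk2020, Thm. 20] -/
theorem AlonKumarVolk2020_thm20_holds : AlonKumarVolk2020_thm20.{u} := by
  obtain ⟨n₀, hn₀3, hlarge⟩ := AKV.exists_large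
  have hlog2 : 0 < Real.log 2 := Real.log_pos (by norm_num)
  refine ⟨min (1 / 675840) (Real.log 2 ^ 2 / (n₀ : ℝ) ^ 2), lt_min (by norm_num) (by positivity), ?_⟩
  intro K _ n hn g hg P h2 hsm hP
  have hn0 : (0 : ℝ) < n := by exact_mod_cast (show 0 < n by omega)
  have hlogn : Real.log 2 ≤ Real.log n := Real.log_le_log (by norm_num) (by exact_mod_cast hn)
  have hlogn0 : 0 < Real.log n := hlog2.trans_le hlogn
  by_cases hbig : n₀ ≤ n
  · have hb := AKV.size_bound (hn₀3.trans hbig) (hlarge n hbig) hg h2 hsm hP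
    refine le_trans ?_ hb
    rw [div_le_div_iff₀ (by positivity) (by positivity)]
    have hmin : min (1 / 675840) (Real.log 2 ^ 2 / (n₀ : ℝ) ^ 2) ≤ 1 / 675840 := min_le_left _ _
    have : (0 : ℝ) ≤ (n : ℝ) ^ 2 * Real.log n ^ 2 := by positivity
    nlinarith
  · push Not at hbig
    have hs : (1 : ℝ) ≤ P.size := by exact_mod_cast AKV.one_le_size hn hg h2 hsm hP
    refine le_trans ?_ hs
    rw [div_le_one (by positivity)]
    have hmin : min (1 / 675840) (Real.log 2 ^ 2 / (n₀ : ℝ) ^ 2) ≤ Real.log 2 ^ 2 / (n₀ : ℝ) ^ 2 :=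
      min_le_right _ _
    have hnn₀ : (n : ℝ) ^ 2 ≤ (n₀ : ℝ) ^ 2 := by
      have : (n : ℝ) ≤ n₀ := by exact_mod_cast hbig.le
      nlinarith
    have hn₀pos : (0 : ℝ) < (n₀ : ℝ) ^ 2 := by
      have : (3 : ℝ) ≤ n₀ := by exact_mod_cast hn₀3
      positivity
    have hl : Real.log 2 ^ 2 ≤ Real.log n ^ 2 := by nlinarith
    calc min (1 / 675840) (Real.log 2 ^ 2 / (n₀ : ℝ) ^ 2) * (n : ℝ) ^ 2
        ≤ Real.log 2 ^ 2 / (n₀ : ℝ) ^ 2 * (n : ℝ) ^ 2 :=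
          mul_le_mul_of_nonneg_right hmin (by positivity)
      _ ≤ Real.log 2 ^ 2 / (n₀ : ℝ) ^ 2 * (n₀ : ℝ) ^ 2 :=
          mul_le_mul_of_nonneg_left hnn₀ (by positivity)
      _ = Real.log 2 ^ 2 := by field_simp
      _ ≤ Real.log n ^ 2 := hl

end Literature.Barriers.ValiantsHypothesis

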